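import Summits.PneNP.PneNP.Theses.RootDecompMultipartyNOF
import Literature.Barriers.PneNP.NOFLogNBarrier
import Literature.Computability.Complexity.BoolEncodings
import Literature.Computability.Complexity.CHFunctions
import Literature.Computability.Complexity.PCPCoins

/-!
# `RootDecompMultipartyNOF.TransferAtOne` (stmt-PneNP-31651) — the decided two-player calibration of the NOF dial

Node N31 of the decomp-pnenp root-decomposition cell (route `route-PneNP-RootDecompMultipartyNOF`) records, as an
aside, the DECIDED bottom of its player-threshold dial: with threshold `1` (two players admitted) and ANY
polylogarithmic per-player allowance, Algorithmica cannot place all of `P` inside the simultaneous-NOF-easy class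
— indeed OUTRIGHT `P ⊄ ⋃ₑ {L | every (k,n)-slice with k ≥ 2 has a valid simultaneous k-party NOF protocol of cost
≤ k·(⌊log₂(kn)⌋+2)ᵉ}`: the P-language `EQL = {⟨u,v⟩ | val u = val v}` (tree `eqVal_mem_P`) needs `m` bits in every
valid simultaneous TWO-player protocol for its halves-slice at row length `2m + 2` (player 1's message sees row 0
only and must be injective on a fooling set of `2^m` rows), while `2·(⌊log₂(4m+4)⌋+2)ᵉ < m` for large `m`.
Verbatim port (declarations made `private`) of the lens-4 g9 kernel block `sliceNOF`, `plog`, `twoRows`,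
`card_le_two_pow_cost`, `EQL`, `encRow`/`padRow`, `le_cost_sliceNOF_EQL`, `eventually_mul_plog_lt`,
`exists_two_mul_plog_lt` (CommunicationLift.lean 87b2f764 §1/§5; lens `transferAt_one`, cited «DECIDED, provable
now» in the route file).  [Jukna2012 Ch. 4–5; folklore]  0 sorry.
-/

namespace Summit.PneNP.PneNP.Theorems

open Literature.Computability.Complexity
open Literature.Barriers.PneNP
open Finset Filter

/-- support (model) — the `(k,n)`-SLICE of a language as a `k`-party NOF function: the `k × n` input matrix is
read row-major (player `i`'s forehead carries the `i`-th block of `n` consecutive bits, Mathlib's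
`finProdFinEquiv (i, j) = j + n·i`), and the slice is `X ↦ [flatten X ∈ L]`. [cite: Jukna2012, Ch. 5 (PDF p. 155)] -/
private noncomputable def sliceNOF (L : Language Bool) (k n : ℕ) : NOFInput k n → Bool :=
  fun X => L.sliceFn (k * n) (flattenNOF X)

/-- The slice evaluates the indicator of `L` on the flattened word. Port of lens-4 g9. [folklore] -/
private theorem sliceNOF_apply (L : Language Bool) (k n : ℕ) (X : NOFInput k n) :
    sliceNOF L k n X = L.boolIndicator (List.ofFn (flattenNOF X)) := rfl


/-- support (scale) — the polylogarithmic scale `plog e N = (⌊log₂ N⌋ + 2)ᵉ` (always `≥ 1`, `≥ 2ᵉ`). [folklore] -/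
private def plog (e N : ℕ) : ℕ := (Nat.log 2 N + 2) ^ e

/-- `2ᵉ ≤ plog e N`. Port of lens-4 g9. [folklore] -/
private theorem two_pow_le_plog (e N : ℕ) : 2 ^ e ≤ plog e N := Nat.pow_le_pow_left (by omega) e

/-- `1 ≤ plog e N`. Port of lens-4 g9. [folklore] -/
private theorem one_le_plog (e N : ℕ) : 1 ≤ plog e N := (Nat.one_le_two_pow).trans (two_pow_le_plog e N)

/-- `plog` is monotone in the exponent. Port of lens-4 g9. [folklore] -/
private theorem plog_mono {e e' : ℕ} (h : e ≤ e') (N : ℕ) : plog e N ≤ plog e' N :=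
  Nat.pow_le_pow_right (by omega) h

/-- The two-player NOF input with rows `x` (player `0`'s forehead) and `y`. [folklore] -/
private def twoRows {m : ℕ} (x y : Fin m → Bool) : NOFInput 2 m := fun i => if i = 0 then x else y

/-- Row `0` of `twoRows x y` is `x`. Port of lens-4 g9. [folklore] -/
@[simp] private theorem twoRows_zero {m : ℕ} (x y : Fin m → Bool) : twoRows x y 0 = x := by simp [twoRows]

/-- Row `1` of `twoRows x y` is `y`. Port of lens-4 g9. [folklore] -/
@[simp] private theorem twoRows_one {m : ℕ} (x y : Fin m → Bool) : twoRows x y 1 = y := by simp [twoRows]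

/-- Updating row `1` of a two-row input. Port of lens-4 g9. [folklore] -/
private theorem update_twoRows_one {m : ℕ} (x y y' : Fin m → Bool) :
    Function.update (twoRows x y) 1 y' = twoRows x y' := by
  funext i
  by_cases h : i = 1
  · subst h; simp
  · have h0 : i = 0 := by omega
    subst h0
    rw [Function.update_of_ne h, twoRows_zero, twoRows_zero]

/-- Updating row `0` of a two-row input. Port of lens-4 g9. [folklore] -/
private theorem update_twoRows_zero {m : ℕ} (x x' y : Fin m → Bool) :
    Function.update (twoRows x y) 0 x' = twoRows x' y := by
  funext i
  by_cases h : i = 0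
  · subst h; simp
  · have h1 : i = 1 := by omega
    subst h1
    rw [Function.update_of_ne h, twoRows_one, twoRows_one]

/-- **The two-party counting bound (distinct rows).** If the rows `row a`, `a : ι`, of `F` are pairwise
distinguishable by some second row, then every valid simultaneous two-player protocol for `F` has `|ι| ≤ 2^cost`
(player `1`'s message sees row `0` only and must be injective on the rows). [cite: Jukna2012, Ch. 4–5 (one-way and
simultaneous messages)] -/
private theorem card_le_two_pow_cost {m : ℕ} {F : NOFInput 2 m → Bool} (S : SimultaneousProtocol 2 m)
    (hV : S.Valid) (he : ∀ X, S.eval X = F X) {ι : Type} [Fintype ι] (row : ι → Fin m → Bool)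
    (hsep : ∀ a b : ι, a ≠ b → ∃ y, F (twoRows (row a) y) ≠ F (twoRows (row b) y)) :
    Fintype.card ι ≤ 2 ^ S.cost := by
  classical
  have hmsg1 : ∀ x y y' : Fin m → Bool, S.msg 1 (twoRows x y') = S.msg 1 (twoRows x y) := by
    intro x y y'
    rw [← update_twoRows_one x y y']
    exact hV 1 _ _
  have hmsg0 : ∀ x x' y : Fin m → Bool, S.msg 0 (twoRows x' y) = S.msg 0 (twoRows x y) := by
    intro x x' y
    rw [← update_twoRows_zero x x' y]
    exact hV 0 _ _
  let Φ : ι → (Fin (S.len 1) → Bool) := fun a => S.msg 1 (twoRows (row a) fun _ => false)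
  have key : ∀ a b : ι, Φ a = Φ b → ∀ y, F (twoRows (row a) y) = F (twoRows (row b) y) := by
    intro a b hab y
    rw [← he, ← he]
    unfold SimultaneousProtocol.eval
    congr 1
    funext i
    by_cases hi : i = 0
    · subst hi
      exact hmsg0 _ _ _
    · have h1 : i = 1 := by omega
      subst h1
      calc S.msg 1 (twoRows (row a) y) = Φ a := hmsg1 _ _ _
        _ = Φ b := hab
        _ = S.msg 1 (twoRows (row b) y) := (hmsg1 _ _ _).symm
  have hΦ : Function.Injective Φ := by
    intro a b hab
    by_contra hne
    obtain ⟨y, hy⟩ := hsep a b hne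
    exact hy (key a b hab y)
  have hcard := Fintype.card_le_of_injective Φ hΦ
  simp only [Fintype.card_fun, Fintype.card_fin, Fintype.card_bool] at hcard
  refine hcard.trans (Nat.pow_le_pow_right (by norm_num) ?_)
  exact Finset.single_le_sum (f := S.len) (fun _ _ => Nat.zero_le _) (mem_univ (1 : Fin 2))

/-- Reading a NOF input as a word: entry `(i, j)` is bit `i·n + j`. [folklore] -/
private theorem flattenNOF_mk {k n : ℕ} (X : NOFInput k n) (i : Fin k) (j : Fin n) (h : (i : ℕ) * n + j < k * n) :
    flattenNOF X ⟨i * n + j, h⟩ = X i j := by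
  have hij : (⟨(i : ℕ) * n + j, h⟩ : Fin (k * n)) = finProdFinEquiv (i, j) :=
    Fin.ext (by simp [finProdFinEquiv_apply_val]; ring)
  unfold flattenNOF
  rw [hij, Equiv.symm_apply_apply]

/-- The word of a NOF input is the concatenation of its rows (row-major). [folklore] -/
private theorem ofFn_flattenNOF {k n : ℕ} (X : NOFInput k n) :
    List.ofFn (flattenNOF X) = (List.ofFn fun i => List.ofFn (X i)).flatten := by
  rw [List.ofFn_mul]
  exact congrArg List.flatten
    (congrArg List.ofFn (funext fun i => congrArg List.ofFn (funext fun j => flattenNOF_mk X i j _)))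

/-- Two players: the word is `row 0 ++ row 1` — the HALVES partition. [folklore] -/
private theorem ofFn_flattenNOF_twoRows {m : ℕ} (x y : Fin m → Bool) :
    List.ofFn (flattenNOF (twoRows x y)) = List.ofFn x ++ List.ofFn y := by
  rw [ofFn_flattenNOF]
  simp [List.ofFn_succ, twoRows]

/-- support (witness) — `EQL = {⟨u, v⟩ | val u = val v}`: numeric equality of the two components of the tree's
self-delimiting pair `boolPair u v = double(u) ++ 01 ++ v`. [cite: AroraBarak2009, §0.1] -/
private def EQL : Language Bool := {w | bitsToNat (fstP w) = bitsToNat (sndP w)}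

/-- `EQL ∈ P` (tree: `eqVal_mem_P`). [folklore] -/
private theorem EQL_mem_P : EQL ∈ Classes.P := eqVal_mem_P

/-- Row `0` for the fooling set: the `x`-part `double(u) ++ 01` of a pair, `|u| = m`, as a row of `m + (m+2)` bits. -/
private def encRow {m : ℕ} (u : Fin m → Bool) : Fin (m + (m + 2)) → Bool :=
  fun j => (boolPair (List.ofFn u) []).get (j.cast (by rw [length_boolPair, List.length_ofFn, List.length_nil]; omega))

/-- Row `1` for the fooling set: `u` padded with `m + 2` zeros (same numeric value). -/
private def padRow {m : ℕ} (u : Fin m → Bool) : Fin (m + (m + 2)) → Bool :=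
  Fin.append u fun _ => false

/-- `List.ofFn` of `get` along a length cast is the list (bookkeeping). Port of lens-4 g9. [folklore] -/
private theorem ofFn_get_cast (l : List Bool) {n : ℕ} (h : n = l.length) :
    List.ofFn (fun j : Fin n => l.get (j.cast h)) = l := by
  subst h
  simp

/-- The word of `encRow u` is `boolPair (ofFn u) []`. Port of lens-4 g9. [folklore] -/
private theorem ofFn_encRow {m : ℕ} (u : Fin m → Bool) : List.ofFn (encRow u) = boolPair (List.ofFn u) [] :=
  ofFn_get_cast _ _

/-- The word of `padRow u` is `ofFn u` followed by `m + 2` zeros. Port of lens-4 g9. [folklore] -/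
private theorem ofFn_padRow {m : ℕ} (u : Fin m → Bool) :
    List.ofFn (padRow u) = List.ofFn u ++ List.replicate (m + 2) false := by
  rw [padRow, List.ofFn_fin_append, List.ofFn_const]

/-- `boolPair x [] ++ z = boolPair x z`. Port of lens-4 g9. [folklore] -/
private theorem boolPair_nil_append (x z : List Bool) : boolPair x [] ++ z = boolPair x z := by
  simp [boolPair]

/-- The halves-slice of `EQL` on the fooling rows: `[val (ofFn u) = val (ofFn y)]`. -/
private theorem sliceNOF_EQL_encRow {m : ℕ} (u : Fin m → Bool) (y : Fin (m + (m + 2)) → Bool) :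
    sliceNOF EQL 2 (m + (m + 2)) (twoRows (encRow u) y) =
      decide (bitsToNat (List.ofFn u) = bitsToNat (List.ofFn y)) := by
  rw [sliceNOF_apply, ofFn_flattenNOF_twoRows, ofFn_encRow, boolPair_nil_append]
  by_cases h : bitsToNat (List.ofFn u) = bitsToNat (List.ofFn y)
  · rw [decide_eq_true h]
    exact (Set.mem_iff_boolIndicator _ _).1 (by simpa [EQL, fstP_boolPair, sndP_boolPair] using h)
  · rw [decide_eq_false h]
    exact (Set.notMem_iff_boolIndicator _ _).1 (by simpa [EQL, fstP_boolPair, sndP_boolPair] using h)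

/-- Padding with zeros keeps the numeric value. Port of lens-4 g9. [folklore] -/
private theorem bitsToNat_ofFn_padRow {m : ℕ} (u : Fin m → Bool) :
    bitsToNat (List.ofFn (padRow u)) = bitsToNat (List.ofFn u) := by
  rw [ofFn_padRow, bitsToNat_append, bitsToNat_replicate_false, mul_zero, add_zero]

/-- The fooling matrix: row `u` against column `padRow v` reads `[u = v]`. -/
private theorem sliceNOF_EQL_fool {m : ℕ} (u v : Fin m → Bool) :
    sliceNOF EQL 2 (m + (m + 2)) (twoRows (encRow u) (padRow v)) = decide (u = v) := by
  rw [sliceNOF_EQL_encRow, bitsToNat_ofFn_padRow]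
  by_cases h : u = v
  · subst h; simp
  · rw [decide_eq_false h, decide_eq_false]
    intro hval
    apply h
    have hl : List.ofFn u = List.ofFn v :=
      PCPCoins.bitsToNat_injective_of_length (by simp) hval
    exact List.ofFn_injective hl

/-- BOTTOM RUNG, quantitative (kernel): every valid simultaneous TWO-player protocol for the halves-slice of `EQL`
at row length `2m + 2` costs at least `m` bits. [folklore] -/
private theorem le_cost_sliceNOF_EQL {m : ℕ} (S : SimultaneousProtocol 2 (m + (m + 2))) (hV : S.Valid)
    (he : ∀ X, S.eval X = sliceNOF EQL 2 (m + (m + 2)) X) : m ≤ S.cost := by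
  have h := card_le_two_pow_cost S hV he encRow fun a b hab =>
    ⟨padRow a, by rw [sliceNOF_EQL_fool, sliceNOF_EQL_fool, decide_eq_true rfl, decide_eq_false (Ne.symm hab)]; simp⟩
  simp only [Fintype.card_fun, Fintype.card_fin, Fintype.card_bool] at h
  exact (Nat.pow_le_pow_iff_right (by norm_num)).1 h

/-- `(log₂ n)ᵉ < n` for all large `n` (from `(log x)ᵉ = o(x)`; as in the tree's `WideBlockMajMajTwoPlayers`). [folklore] -/
private theorem eventually_logb_two_pow_lt (e : ℕ) : ∀ᶠ n : ℕ in atTop, Real.logb 2 n ^ e < n := by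
  have hl2 : 0 < Real.log 2 ^ e := pow_pos (Real.log_pos one_lt_two) e
  have hlo := (Real.isLittleO_pow_log_id_atTop (n := e)).def (half_pos hl2)
  have hnat := tendsto_natCast_atTop_atTop.eventually hlo
  filter_upwards [hnat, eventually_ge_atTop 1] with n hn hn1
  have hnpos : (0 : ℝ) < n := by exact_mod_cast hn1
  have hlog0 : 0 ≤ Real.log n := Real.log_nonneg (by exact_mod_cast hn1)
  rw [Real.norm_of_nonneg (pow_nonneg hlog0 e), id, Real.norm_of_nonneg hnpos.le] at hn
  rw [Real.logb, div_pow, div_lt_iff₀ hl2]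
  calc Real.log n ^ e ≤ Real.log 2 ^ e / 2 * n := hn
    _ < n * Real.log 2 ^ e := by nlinarith

/-- Polylog is eventually below linear: `a (⌊log₂ n⌋ + 2)ᵉ < n` for all large `n`. [folklore] -/
private theorem eventually_mul_plog_lt (a e : ℕ) : ∀ᶠ n : ℕ in atTop, a * (Nat.log 2 n + 2) ^ e < n := by
  have hK : ∀ᶠ n : ℕ in atTop, ((a : ℝ) * 2 ^ e) ≤ Real.logb 2 n :=
    ((Real.tendsto_logb_atTop one_lt_two).comp tendsto_natCast_atTop_atTop).eventually_ge_atTop _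
  filter_upwards [eventually_logb_two_pow_lt (e + 1), hK, eventually_ge_atTop 4] with n h1 h2 h3
  have hn0 : (0 : ℝ) < n := by exact_mod_cast (show 0 < n by omega)
  have hL : (Nat.log 2 n : ℝ) ≤ Real.logb 2 n := by
    rw [Real.le_logb_iff_rpow_le one_lt_two hn0, Real.rpow_natCast]
    exact_mod_cast Nat.pow_log_le_self 2 (by omega)
  have h2L : (2 : ℝ) ≤ Real.logb 2 n := by
    rw [Real.le_logb_iff_rpow_le one_lt_two hn0, Real.rpow_two]
    have h4 : (4 : ℝ) ≤ n := by exact_mod_cast h3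
    nlinarith
  have hl0 : 0 ≤ Real.logb 2 n := by linarith
  have hA : ((Nat.log 2 n : ℕ) : ℝ) + 2 ≤ 2 * Real.logb 2 n := by linarith
  have hB : (a : ℝ) * ((Nat.log 2 n : ℝ) + 2) ^ e ≤ Real.logb 2 n ^ (e + 1) :=
    calc (a : ℝ) * ((Nat.log 2 n : ℝ) + 2) ^ e ≤ a * (2 * Real.logb 2 n) ^ e := by
          gcongr
      _ = (a * 2 ^ e) * Real.logb 2 n ^ e := by ring
      _ ≤ Real.logb 2 n * Real.logb 2 n ^ e := mul_le_mul_of_nonneg_right h2 (pow_nonneg hl0 e)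
      _ = Real.logb 2 n ^ (e + 1) := by ring
  have : ((a * (Nat.log 2 n + 2) ^ e : ℕ) : ℝ) < n := by
    push_cast
    linarith
  exact_mod_cast this

/-- `⌊log₂(m·m)⌋ ≤ 2⌊log₂ m⌋ + 1`. Port of lens-4 g9. [folklore] -/
private theorem log_two_mul_self_le (m : ℕ) (hm : m ≠ 0) : Nat.log 2 (m * m) ≤ 2 * Nat.log 2 m + 1 := by
  have h := Nat.lt_pow_succ_log_self (b := 2) (by norm_num) m
  have h2 : m * m < 2 ^ (2 * Nat.log 2 m + 2) := by
    calc m * m < 2 ^ (Nat.log 2 m).succ * 2 ^ (Nat.log 2 m).succ :=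
          Nat.mul_lt_mul_of_lt_of_le h h.le (by positivity)
      _ = 2 ^ (2 * Nat.log 2 m + 2) := by rw [← pow_add]; congr 1; omega
  have := Nat.log_lt_of_lt_pow (by positivity) h2
  omega

/-- The bottom rung needs: for some `m`, `2 · plog e (4m+4) < m`. -/
private theorem exists_two_mul_plog_lt (e : ℕ) : ∃ m : ℕ, 2 * plog e (2 * (m + (m + 2))) < m := by
  obtain ⟨m, hm⟩ := ((eventually_mul_plog_lt (2 * 2 ^ e) e).and (eventually_ge_atTop 5)).exists
  refine ⟨m, ?_⟩
  obtain ⟨hlt, hm5⟩ := hm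
  have hsq : 2 * (m + (m + 2)) ≤ m * m := by nlinarith
  have hlog : Nat.log 2 (2 * (m + (m + 2))) + 2 ≤ 2 * (Nat.log 2 m + 2) := by
    have := (Nat.log_mono_right hsq).trans (log_two_mul_self_le m (by omega))
    omega
  calc 2 * plog e (2 * (m + (m + 2))) ≤ 2 * (2 * (Nat.log 2 m + 2)) ^ e :=
        Nat.mul_le_mul_left 2 (Nat.pow_le_pow_left hlog e)
    _ = 2 * 2 ^ e * (Nat.log 2 m + 2) ^ e := by rw [mul_pow]; ring
    _ < m := hlt


/-- `TransferAtOne` (stmt-PneNP-31651): `NP ⊆ P → ¬ (P ⊆ ⋃ e, {L | ∀ k n, 2 ≤ k → 1 < k → the (k,n)-slice of L has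
a valid simultaneous NOF protocol of cost ≤ k·(⌊log₂(kn)⌋+2)ᵉ})` — holds outright: `EQL ∈ P` and its two-player
halves-slice at row length `2m+2` costs ≥ m > 2·(⌊log₂(4m+4)⌋+2)ᵉ (decomp-pnenp cell N31, bottom of the player
dial; port of lens-4 g9 `transferAt_one`, 2026-08-30). -/
theorem transferAtOne_proof :
    Summit.PneNP.PneNP.Theses.RootDecompMultipartyNOF.TransferAtOne := by
  unfold Summit.PneNP.PneNP.Theses.RootDecompMultipartyNOF.TransferAtOne
  intro _ hP
  obtain ⟨e, he⟩ := Set.mem_iUnion.1 (hP EQL_mem_P)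
  obtain ⟨m, hm⟩ := exists_two_mul_plog_lt e
  obtain ⟨S, hV, hc, hev⟩ := he 2 (m + (m + 2)) le_rfl (by norm_num)
  have h1 := le_cost_sliceNOF_EQL S hV (fun X => by rw [hev X]; rfl)
  have h2 : S.cost ≤ 2 * plog e (2 * (m + (m + 2))) := hc
  omega

end Summit.PneNP.PneNP.Theorems
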